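import Summits.Schanuel.Schanuel.Theorems.RootDecomp1KHyper34

/-!
# RootDecomp1KHyper — lens 6, generation 15 ADDENDUM «EXP-LATTICE-ANCHORED CELL» (ExpAnchorT.lean v2 88910796…, 2341 l) — continuation (RootDecomp1KHyper35): §5d (rest: `int_free_one_yev_yod`; the plane-lemma block itself comes from Hyper26), §5e `span_coords`, `not_hasHLPairInSpan_latTriple_yC`, `linearIndependent_latTriple_yC`; §5f member z_C = (1, e^{i√2}, y_C) incl. `residualDomain_zC` (hypothesis-free), `rank3SpanResidual_instance_zC`; §6 placement vs the g15 cell, combined carve `rank3SpanResidual_iff_unanchored₂`, `placement_zC`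

(lens-6 g15-addendum `ExpAnchorT.lean` v2, sha256 88910796…cc8b, farm rc 0 · 0 sorry · axioms std; port by census-1 gen 14 in eight parts RootDecomp1KHyper28–35, cuts of CENSUS-REQUEST STATUS L1561 re-balanced for the 400-line cap,
critic PORT GO L1568 (e) / ACK L1571; import `RootDecomp1KHyper26`, the source's verbatim g15 plane-lemma copy dropped (exported by Hyper26 in `…HyperCell`), sub-namespace `…HyperCell.LatCell` kept; statements and proofs verbatim
(55 docstrings added, seven generic one-liners privatised with per-part private copies); `hLW : LWMeasure` (tree-proved named fact) stays a binder; `--supports stmt-Schanuel-33363` (residual of record n = 3 := UnanchoredResidual₃′). Nothing here proves Schanuel; rung 0.)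
-/

noncomputable section

open Complex IntermediateField Polynomial

namespace Summit.Schanuel.Schanuel.Theorems.RootDecomp1KHyper

namespace HyperCell

namespace LatCell

variable {n : ℕ}
open Summit.Schanuel.Schanuel.Theorems.RootDecomp1KGeneric (HasHLPairInSpan Rank3SpanResidual
  mem_adjoin_of_mem_span cexp_mem_adjoin_of_mem_span)

/-- Real coefficients on the `ℝ`-basis `(1, ξ)`, `Im ξ ≠ 0`. -/
private theorem real_combo_eq_zero {ξ : ℂ} (hξi : ξ.im ≠ 0) {p q : ℝ} (h : (p : ℂ) + ξ * (q : ℂ) = 0) :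
    p = 0 ∧ q = 0 := by
  have him := congr_arg Complex.im h
  have hre := congr_arg Complex.re h
  simp only [Complex.add_im, Complex.ofReal_im, Complex.mul_im, Complex.ofReal_re, zero_add,
    mul_zero, Complex.zero_im] at him
  have hq : q = 0 := by
    rcases mul_eq_zero.mp him with h1 | h1
    · exact absurd h1 hξi
    · exact h1
  simp only [Complex.add_re, Complex.ofReal_re, Complex.mul_re, Complex.ofReal_im, mul_zero,
    sub_zero, Complex.zero_re, hq, add_zero] at hre
  exact ⟨hre, hq⟩

/-! ### §5d  The plane lemma (verbatim the g15 §6a mechanism) and `ℤ`-freeness of `(1, y⁰, y¹)` -/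

-- PORT (census-1 gen 14): the verbatim g15 §6a plane-lemma block of the source (`hKvec`, `hKvec_zero/one/two`, `Edef`, `Edef_eq`,
-- `Edef_succ`, `two_mul_le_two_pow`, `hexp_le_gap`, `Edef_succ_ne_zero`, `eq_zero_of_Edef_eq_zero`; source ll. 1899–1993) is DROPPED here —
-- the tree's `RootDecomp1KHyper26` exports the same declarations in the parent namespace `…HyperCell` (CENSUS-REQUEST L1561, critic L1568 (e)).

/-- **`(1, y⁰, y¹)` is `ℤ`-free**: an integer relation `n₀ + n₁ y⁰ + n₂ y¹ = 0` is trivial.  (At the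
index `K = |n₁| + |n₂| + 2` the integer `n₀ 2^{a_K} + n₁ P_K + n₂ M_K = −2^{a_K}(n₁ τ⁰ + n₂ τ¹)` has
absolute value `< 1`, so vanishes; the plane lemma then kills `n`.) -/
theorem int_free_one_yev_yod (n₀ n₁ n₂ : ℤ) (h : (n₀ : ℝ) + n₁ * yev + n₂ * yod = 0) :
    n₀ = 0 ∧ n₁ = 0 ∧ n₂ = 0 := by
  obtain ⟨N, hN⟩ : ∃ N : ℕ, N = n₁.natAbs + n₂.natAbs := ⟨_, rfl⟩
  obtain ⟨K, hK⟩ : ∃ K : ℕ, K = N + 2 := ⟨_, rfl⟩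
  set n : Fin 3 → ℤ := ![-n₁, -n₂, n₀] with hn
  -- tails at K+1
  set τ₀ : ℝ := ∑' k, evt (k + (K + 1)) with hτ₀
  set τ₁ : ℝ := ∑' k, odt (k + (K + 1)) with hτ₁
  have hτ₀0 : 0 ≤ τ₀ := evt_tail_nonneg _
  have hτ₁0 : 0 ≤ τ₁ := odt_tail_nonneg _
  have hsum : τ₀ + τ₁ = ∑' k, 1 / (2 : ℝ) ^ hexp (k + (K + 1)) := evt_tail_add_odt_tail _
  have hev : yev = (pmP K : ℝ) / (2 : ℝ) ^ hexp K + τ₀ := by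
    rw [yev_eq_partialSum_add_tail (K + 1), partialSum_evt]
  have hod : yod = (pmM K : ℝ) / (2 : ℝ) ^ hexp K + τ₁ := by
    rw [yod_eq_partialSum_add_tail (K + 1), partialSum_odt]
  have h2 : (0 : ℝ) < 2 ^ hexp K := by positivity
  -- the integer
  have hI : ((Edef n K : ℤ) : ℝ) = -(2 : ℝ) ^ hexp K * ((n₁ : ℝ) * τ₀ + n₂ * τ₁) := by
    rw [Edef_eq, hn]
    simp only [Matrix.cons_val_zero, Matrix.cons_val_one, Matrix.head_cons, Matrix.cons_val_two,
      Matrix.tail_cons]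
    push_cast
    have h' : (2 : ℝ) ^ hexp K * ((n₀ : ℝ) + n₁ * yev + n₂ * yod) = 0 := by rw [h, mul_zero]
    rw [hev, hod] at h'
    field_simp at h'
    linear_combination h'
  -- its size
  have hgap : (2 : ℝ) ^ hexp K * (2 : ℝ) ^ (K + 1) ≤ (2 : ℝ) ^ hexp (K + 1) := by
    rw [← pow_add]
    apply pow_le_pow_right₀ (by norm_num)
    have h1 : K + 1 ≤ hexp (K + 1) - hexp K := (succ_le_hexp K).trans (hexp_le_gap K)
    have h3 := hexp_lt_succ K
    omega
  have hNlt : ((N : ℕ) : ℝ) * 2 < (2 : ℝ) ^ (K + 1) := by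
    have h1 : N * 2 < 2 ^ (K + 1) := by
      rw [hK, pow_succ]
      have := @Nat.lt_two_pow_self N
      have h4 : 2 ^ N ≤ 2 ^ (N + 2) := Nat.pow_le_pow_right (by norm_num) (by omega)
      omega
    exact_mod_cast h1
  have habsI : |((Edef n K : ℤ) : ℝ)| < 1 := by
    rw [hI, abs_mul, abs_neg, abs_of_pos h2]
    have hb : |(n₁ : ℝ) * τ₀ + n₂ * τ₁| ≤ (N : ℝ) * (τ₀ + τ₁) := by
      have hNR : (N : ℝ) = |(n₁ : ℝ)| + |(n₂ : ℝ)| := by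
        rw [hN]; push_cast; simp only [Nat.cast_natAbs, Int.cast_abs]
      have e1 : |(n₁ : ℝ)| ≤ N := by rw [hNR]; linarith only [abs_nonneg (n₂ : ℝ)]
      have e2 : |(n₂ : ℝ)| ≤ N := by rw [hNR]; linarith only [abs_nonneg (n₁ : ℝ)]
      calc |(n₁ : ℝ) * τ₀ + n₂ * τ₁| ≤ |(n₁ : ℝ) * τ₀| + |(n₂ : ℝ) * τ₁| := abs_add_le _ _
        _ = |(n₁ : ℝ)| * τ₀ + |(n₂ : ℝ)| * τ₁ := by
            rw [abs_mul, abs_mul, abs_of_nonneg hτ₀0, abs_of_nonneg hτ₁0]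
        _ ≤ N * τ₀ + N * τ₁ := by gcongr
        _ = (N : ℝ) * (τ₀ + τ₁) := by ring
    have htail : τ₀ + τ₁ ≤ 2 * (1 / (2 : ℝ) ^ hexp (K + 1)) := by rw [hsum]; exact lambdaH_tail_le _
    have h2K : (0 : ℝ) < 2 ^ hexp (K + 1) := by positivity
    calc (2 : ℝ) ^ hexp K * |(n₁ : ℝ) * τ₀ + n₂ * τ₁| ≤ 2 ^ hexp K * ((N : ℝ) * (τ₀ + τ₁)) := by gcongr
      _ ≤ 2 ^ hexp K * ((N : ℝ) * (2 * (1 / (2 : ℝ) ^ hexp (K + 1)))) := by gcongr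
      _ = (2 ^ hexp K * ((N : ℝ) * 2)) / (2 : ℝ) ^ hexp (K + 1) := by field_simp
      _ < (2 ^ hexp K * (2 : ℝ) ^ (K + 1)) / (2 : ℝ) ^ hexp (K + 1) := by gcongr
      _ ≤ 1 := by rw [div_le_one h2K]; exact hgap
  have hI0 : Edef n K = 0 := by
    have : |Edef n K| < 1 := by exact_mod_cast (show ((|Edef n K| : ℤ) : ℝ) < 1 by push_cast; exact habsI)
    exact Int.abs_lt_one_iff.mp this
  have hn0 : n = 0 := by
    refine eq_zero_of_Edef_eq_zero (K := K) ?_ hI0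
    rw [hn]
    simp only [Matrix.cons_val_zero, Matrix.cons_val_one, Int.natAbs_neg]
    omega
  have e0 := congr_fun hn0 0
  have e1 := congr_fun hn0 1
  have e2 := congr_fun hn0 2
  simp only [hn, Matrix.cons_val_zero, Matrix.cons_val_one, Matrix.head_cons, Matrix.cons_val_two,
    Matrix.tail_cons, Pi.zero_apply, neg_eq_zero] at e0 e1 e2
  exact ⟨e2, e0, e1⟩

/-! ### §5e  NO hyper-Liouville pair in `span_ℤ(1, ξ, y_C(ξ))` for `Im ξ ≠ 0` — UNCONDITIONAL -/

/-- Span elements in the `ℝ`-basis `(1, ξ)`: `a + bξ + c y_C = (a + c y⁰) + (b + c y¹) ξ`. -/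
theorem span_coords (ξ : ℂ) (u : Fin 3 → ℤ) :
    ∑ i, u i • latTriple 1 ξ (yC ξ) i =
      (((u 0 : ℝ) + (u 2 : ℝ) * yev : ℝ) : ℂ) + ξ * (((u 1 : ℝ) + (u 2 : ℝ) * yod : ℝ) : ℂ) := by
  rw [Fin.sum_univ_three]
  simp only [latTriple_zero, latTriple_one, latTriple_two, zsmul_eq_mul, yC]
  push_cast
  ring

/-- **THEOREM (unconditional).**  For `Im ξ ≠ 0` the triple `(1, ξ, y_C(ξ))` has NO hyper-Liouville
pair in its `ℤ`-span: a real ratio of two span elements is RATIONAL. -/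
theorem not_hasHLPairInSpan_latTriple_yC {ξ : ℂ} (hξi : ξ.im ≠ 0) :
    ¬ HasHLPairInSpan (latTriple 1 ξ (yC ξ)) := by
  rintro ⟨v, ρ, hv0, hρ, hv, hρv⟩
  obtain ⟨u, hu⟩ := (Submodule.mem_span_range_iff_exists_fun ℤ).mp hv
  obtain ⟨u', hu'⟩ := (Submodule.mem_span_range_iff_exists_fun ℤ).mp hρv
  rw [span_coords] at hu hu'
  set a : ℤ := u 0
  set b : ℤ := u 1
  set c : ℤ := u 2
  set a' : ℤ := u' 0
  set b' : ℤ := u' 1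
  set c' : ℤ := u' 2
  set s₀ : ℝ := (a : ℝ) + (c : ℝ) * yev with hs₀
  set s₁ : ℝ := (b : ℝ) + (c : ℝ) * yod with hs₁
  set s₀' : ℝ := (a' : ℝ) + (c' : ℝ) * yev with hs₀'
  set s₁' : ℝ := (b' : ℝ) + (c' : ℝ) * yod with hs₁'
  -- ρ v = v' in coordinates
  have hdiff : ((s₀' - ρ * s₀ : ℝ) : ℂ) + ξ * ((s₁' - ρ * s₁ : ℝ) : ℂ) = 0 := by
    have e : (ρ : ℂ) * v = (ρ : ℂ) * ((s₀ : ℂ) + ξ * (s₁ : ℂ)) := by rw [hu]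
    rw [← hu'] at e
    push_cast
    linear_combination e
  obtain ⟨h0, h1⟩ := real_combo_eq_zero hξi hdiff
  -- the minors relation: s₀' s₁ = s₁' s₀
  have hrel : ((a' * b - a * b' : ℤ) : ℝ) + ((b * c' - b' * c : ℤ) : ℝ) * yev +
      ((a' * c - a * c' : ℤ) : ℝ) * yod = 0 := by
    have e : s₀' * s₁ - s₁' * s₀ = 0 := by
      have e0 : s₀' = ρ * s₀ := by linarith
      have e1 : s₁' = ρ * s₁ := by linarith
      rw [e0, e1]; ring
    rw [hs₀, hs₁, hs₀', hs₁'] at e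
    push_cast
    linear_combination e
  obtain ⟨m1, m2, m3⟩ := int_free_one_yev_yod _ _ _ hrel
  -- v ≠ 0 ⇒ u ≠ 0; the non-zero coordinate t gives t v' = t' v, so ρ = t'/t ∈ ℚ
  have hvC : v = (a : ℂ) + (b : ℂ) * ξ + (c : ℂ) * yC ξ := by
    rw [← hu, yC, hs₀, hs₁]; push_cast; ring
  have hv'C : (ρ : ℂ) * v = (a' : ℂ) + (b' : ℂ) * ξ + (c' : ℂ) * yC ξ := by
    rw [← hu', yC, hs₀', hs₁']; push_cast; ring
  have hirr := HyperLiouville.irrational hρ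
  have key : ∀ t t' : ℤ, t ≠ 0 → (t : ℂ) * ((ρ : ℂ) * v) = (t' : ℂ) * v → False := by
    intro t t' ht h
    have h2 : ((t : ℂ) * (ρ : ℂ) - (t' : ℂ)) * v = 0 := by linear_combination h
    rcases mul_eq_zero.mp h2 with h3 | h3
    · have h4 : (ρ : ℝ) = ((t' / t : ℚ) : ℝ) := by
        have htC : (t : ℂ) ≠ 0 := by exact_mod_cast ht
        have h5 : (ρ : ℂ) = (t' : ℂ) / (t : ℂ) := by field_simp; linear_combination h3
        have h6 : ((ρ : ℝ) : ℂ) = ((((t' : ℚ) / (t : ℚ) : ℚ) : ℝ) : ℂ) := by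
          rw [h5]; push_cast; rfl
        exact_mod_cast h6
      exact hirr ⟨t' / t, h4.symm⟩
    · exact hv0 h3
  by_cases ha : a ≠ 0
  · refine key a a' ha ?_
    rw [hv'C, hvC]
    have m1C : ((a' : ℂ)) * (b : ℂ) = (a : ℂ) * (b' : ℂ) := by exact_mod_cast (sub_eq_zero.mp m1)
    have m3C : ((a' : ℂ)) * (c : ℂ) = (a : ℂ) * (c' : ℂ) := by exact_mod_cast (sub_eq_zero.mp m3)
    linear_combination (-ξ) * m1C - (yC ξ) * m3C
  · push Not at ha
    by_cases hb : b ≠ 0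
    · refine key b b' hb ?_
      rw [hv'C, hvC]
      have m1C : ((a' : ℂ)) * (b : ℂ) = (a : ℂ) * (b' : ℂ) := by exact_mod_cast (sub_eq_zero.mp m1)
      have m2C : ((b : ℂ)) * (c' : ℂ) = (b' : ℂ) * (c : ℂ) := by exact_mod_cast (sub_eq_zero.mp m2)
      linear_combination m1C + (yC ξ) * m2C
    · push Not at hb
      by_cases hc : c ≠ 0
      · refine key c c' hc ?_
        rw [hv'C, hvC]
        have m2C : ((b : ℂ)) * (c' : ℂ) = (b' : ℂ) * (c : ℂ) := by exact_mod_cast (sub_eq_zero.mp m2)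
        have m3C : ((a' : ℂ)) * (c : ℂ) = (a : ℂ) * (c' : ℂ) := by exact_mod_cast (sub_eq_zero.mp m3)
        linear_combination m3C - ξ * m2C
      · push Not at hc
        apply hv0
        rw [hvC, ha, hb, hc]; simp

/-- **`(1, ξ, y_C(ξ))` is ℚ-free for `Im ξ ≠ 0` — UNCONDITIONAL** (`(1, ξ)` an `ℝ`-basis of `ℂ`
plus the `ℤ`-freeness of `(1, y⁰, y¹)`; `ℤ`-freeness ⇒ `ℚ`-freeness by clearing denominators). -/
theorem linearIndependent_latTriple_yC {ξ : ℂ} (hξi : ξ.im ≠ 0) :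
    LinearIndependent ℚ (latTriple 1 ξ (yC ξ)) := by
  rw [← LinearIndependent.iff_fractionRing ℤ ℚ, Fintype.linearIndependent_iff]
  intro u hu
  rw [span_coords ξ u] at hu
  obtain ⟨h0, h1⟩ := real_combo_eq_zero hξi hu
  obtain ⟨e0, e2, -⟩ := int_free_one_yev_yod (u 0) (u 2) 0
    (by simp only [Int.cast_zero, zero_mul, add_zero]; exact h0)
  have e1 : u 1 = 0 := by
    rw [e2] at h1
    simp only [Int.cast_zero, zero_mul, add_zero] at h1
    exact_mod_cast h1
  intro i
  match i with
  | 0 => exact e0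
  | 1 => exact e1
  | 2 => exact e2

/-! ### §5f  The member `z_C = (1, e^{i√2}, y_C)` -/

/-- `√2 < π`. -/
private theorem sqrt_two_lt_pi : Real.sqrt 2 < Real.pi := by
  have h1 : Real.sqrt 2 ≤ 3 / 2 := (Real.sqrt_le_left (by norm_num)).mpr (by norm_num)
  linarith [Real.pi_gt_three]

/-- `α_C = i√2`. -/
def αC : ℂ := ((Real.sqrt 2 : ℝ) : ℂ) * I

/-- `ξ_C = e^{i√2}`. -/
def ξC : ℂ := cexp αC

/-- `ξ_C = e^{i√2}` has norm `1`. -/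
theorem norm_ξC : ‖ξC‖ = 1 := by rw [ξC, αC]; exact Complex.norm_exp_ofReal_mul_I _

/-- `Im ξ_C = sin √2`. -/
theorem ξC_im : ξC.im = Real.sin (Real.sqrt 2) := by rw [ξC, αC]; exact Complex.exp_ofReal_mul_I_im _

/-- `Im ξ_C ≠ 0` (`0 < √2 < π`). -/
theorem ξC_im_ne_zero : ξC.im ≠ 0 := by
  rw [ξC_im]
  exact (Real.sin_pos_of_pos_of_lt_pi (Real.sqrt_pos.mpr (by norm_num)) sqrt_two_lt_pi).ne'

/-- `α_C = i√2` is algebraic. -/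
theorem isAlgebraic_αC : IsAlgebraic ℚ αC := by
  refine ⟨Polynomial.X ^ 2 + Polynomial.C 2, ?_, ?_⟩
  · intro h
    have := congr_arg (Polynomial.eval 0) h
    simp at this
  · have hs : ((Real.sqrt 2 : ℝ) : ℂ) ^ 2 = 2 := by
      rw [← Complex.ofReal_pow, Real.sq_sqrt (by norm_num : (0 : ℝ) ≤ 2)]; push_cast; rfl
    have hα : αC ^ 2 = -2 := by
      rw [αC, mul_pow, hs, Complex.I_sq]; ring
    simp [hα]

/-- `α_C = i√2` is not rational. -/
theorem αC_ne_ratCast (r : ℚ) : αC ≠ (r : ℂ) := by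
  intro h
  have him := congr_arg Complex.im h
  rw [αC] at him
  simp only [Complex.mul_im, Complex.ofReal_re, Complex.ofReal_im, Complex.I_re, Complex.I_im,
    mul_zero, mul_one, add_zero, Complex.ratCast_im] at him
  exact (Real.sqrt_pos.mpr (by norm_num : (0 : ℝ) < 2)).ne' him

/-- The member `z_C = (1, e^{i√2}, y_C)`, `y_C = y⁰ + e^{i√2} y¹`. -/
def zC : Fin 3 → ℂ := latTriple 1 ξC (yC ξC)

/-- `y_C` is hyper-approximable from `ℤ + ℤe^{i√2}` (unconditional, explicit witnesses). -/
theorem hyperLatApprox_zC : HyperLatApprox 1 ξC (yC ξC) := hyperLatApprox_yC norm_ξC.le ξC_im_ne_zero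

/-- `z_C` is `HyperLinLiouville` (unconditional). -/
theorem hyperLinLiouville_zC : HyperLinLiouville zC := hyperLinLiouville_latTriple hyperLatApprox_zC

/-- `z_C` carries the one-exponential X-cell anchor (unconditional). -/
theorem hasExpIntAnchor_zC : HasExpIntAnchor zC := hasExpIntAnchor_latTriple isAlgebraic_αC αC_ne_ratCast _

/-- The small forms of `z_C` are genuinely ternary at every level (unconditional). -/
theorem ternarySmallForms_zC (m : ℕ) :
    ∃ h : Fin 3 → ℤ, (∀ i, h i ≠ 0) ∧
      ‖∑ i, (h i : ℂ) * zC i‖ < Real.exp (-((1 + ∑ i, |(h i : ℝ)|) ^ m)) :=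
  ternarySmallForms_yC norm_ξC.le ξC_im_ne_zero m

/-- **`z_C` has NO hyper-Liouville pair in its span (unconditional).** -/
theorem not_hasHLPairInSpan_zC : ¬ HasHLPairInSpan zC := not_hasHLPairInSpan_latTriple_yC ξC_im_ne_zero

/-- **`z_C` is ℚ-free — UNCONDITIONAL.** -/
theorem linearIndependent_zC : LinearIndependent ℚ zC := linearIndependent_latTriple_yC ξC_im_ne_zero

/-- (The same via the lattice lower bound, mod the LW measure — kept as a cross-check.) -/
theorem linearIndependent_zC' (hLW : LWMeasure) : LinearIndependent ℚ zC :=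
  linearIndependent_latTriple (latLB_one_cexp hLW isAlgebraic_αC αC_ne_ratCast) hyperLatApprox_zC

/-- **`z_C` LIES IN THE DOMAIN OF `Rank3SpanResidual` — UNCONDITIONALLY**: ℚ-free, `HyperLinLiouville`,
no hyper-Liouville pair in its span (and it carries the X1 anchor). -/
theorem residualDomain_zC :
    LinearIndependent ℚ zC ∧ HyperLinLiouville zC ∧ ¬ HasHLPairInSpan zC ∧ HasExpIntAnchor zC :=
  ⟨linearIndependent_zC, hyperLinLiouville_zC, not_hasHLPairInSpan_zC, hasExpIntAnchor_zC⟩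

/-- ℓ2: the algebraic numbers in `span_ℤ(z_C)` are exactly the integers (mod the LW measure). -/
theorem eq_intCast_of_isAlgebraic_mem_span_zC (hLW : LWMeasure) {v : ℂ}
    (hv : v ∈ Submodule.span ℤ (Set.range zC)) (halg : IsAlgebraic ℚ v) : ∃ a : ℤ, v = a :=
  eq_intCast_of_isAlgebraic_mem_span_latTriple hLW isAlgebraic_αC αC_ne_ratCast hyperLatApprox_zC hv halg

/-- **THE EXPLICIT MEMBER `z_C` (mod the LW measure): `trdeg ℚ(e^{i√2}, y_C, e, e^{e^{i√2}}, e^{y_C}) ≥ 3`.** -/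
theorem sb_three_zC (hLW : LWMeasure) : SB 3 zC :=
  sb_three_of_expIntAnchor hLW linearIndependent_zC hyperLinLiouville_zC hasExpIntAnchor_zC

/-- **CERTIFIED INSTANCE OF THE RESIDUAL (`SB` mod the LW measure).**  `z_C = (1, e^{i√2}, y_C)`
satisfies ALL hypotheses of `Rank3SpanResidual` — ℚ-free, `HyperLinLiouville`, NO hyper-Liouville
pair in its span (all three UNCONDITIONALLY) — it lies in the critic's class ℓ2 (exactly one algebraic line,
genuinely ternary small forms), inside the new X-cell and outside every previously decided cell, and
Schanuel's bound holds for it. -/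
theorem rank3SpanResidual_instance_zC (hLW : LWMeasure) :
    LinearIndependent ℚ zC ∧ HyperLinLiouville zC ∧ ¬ HasHLPairInSpan zC ∧ HasExpIntAnchor zC ∧
      SB 3 zC :=
  ⟨linearIndependent_zC, hyperLinLiouville_zC, not_hasHLPairInSpan_zC, hasExpIntAnchor_zC,
    sb_three_zC hLW⟩

/-! ## §6  Placement against the g15 cell (tree `RootDecomp1KHyper22/23`) and the COMBINED carve -/

/-- `√D` (as a complex number) is algebraic over ℚ. -/
private theorem isAlgebraic_sqrt_natCast_C (D : ℕ) : IsAlgebraic ℚ ((Real.sqrt D : ℝ) : ℂ) := by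
  refine ⟨Polynomial.X ^ 2 - Polynomial.C (D : ℚ), Polynomial.X_pow_sub_C_ne_zero (by norm_num) _, ?_⟩
  have hs : ((Real.sqrt D : ℝ) : ℂ) ^ 2 = (D : ℂ) := by
    rw [← Complex.ofReal_pow, Real.sq_sqrt (Nat.cast_nonneg D)]; push_cast; rfl
  simp [hs]

/-- **ℓ2 ⇒ OUTSIDE the g15 cell.**  A tuple whose ℤ-span meets `ℚ̄` only in `ℤ` has no
real-quadratic anchor (`q₂√D ∈ span`, `q₂ ≠ 0`, would be an algebraic non-rational point). -/
theorem not_hasRealQuadAnchor_of_span_int {N : ℕ} {z : Fin N → ℂ}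
    (h : ∀ v ∈ Submodule.span ℤ (Set.range z), IsAlgebraic ℚ v → ∃ a : ℤ, v = a) :
    ¬ HasRealQuadAnchor z := by
  rintro ⟨D, q₁, q₂, hD, hq₁, hq₂, hm₁, hm₂⟩
  have halg : IsAlgebraic ℚ ((q₂ : ℂ) * ((Real.sqrt D : ℝ) : ℂ)) :=
    (isAlgebraic_algebraMap (R := ℚ) (A := ℂ) q₂).mul (isAlgebraic_sqrt_natCast_C D)
  obtain ⟨a, ha⟩ := h _ hm₂ (by simpa using halg)
  have hre : (q₂ : ℝ) * Real.sqrt D = (a : ℝ) := by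
    have := congr_arg Complex.re ha
    simpa [Complex.mul_re] using this
  have hq₂' : (q₂ : ℝ) ≠ 0 := by exact_mod_cast hq₂
  apply hD
  refine ⟨(a : ℚ) / q₂, ?_⟩
  push_cast
  rw [div_eq_iff hq₂', mul_comm]
  exact hre.symm

/-- The family `(1, e^{α}, y)` is outside the g15 cell (mod the LW measure). -/
theorem not_hasRealQuadAnchor_latTriple_one_cexp (hLW : LWMeasure) {α : ℂ} (hα : IsAlgebraic ℚ α)
    (hirr : ∀ r : ℚ, α ≠ (r : ℂ)) {y : ℂ} (hy : HyperLatApprox 1 (cexp α) y) :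
    ¬ HasRealQuadAnchor (latTriple 1 (cexp α) y) :=
  not_hasRealQuadAnchor_of_span_int fun _ hv halg =>
    eq_intCast_of_isAlgebraic_mem_span_latTriple hLW hα hirr hy hv halg

/-- `z_E` is outside the g15 cell (mod the LW measure). -/
theorem not_hasRealQuadAnchor_zE (hLW : LWMeasure) : ¬ HasRealQuadAnchor zE :=
  not_hasRealQuadAnchor_of_span_int fun _ hv halg => eq_intCast_of_isAlgebraic_mem_span_zE hLW hv halg

/-- `z_C` is outside the g15 cell (mod the LW measure). -/
theorem not_hasRealQuadAnchor_zC (hLW : LWMeasure) : ¬ HasRealQuadAnchor zC :=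
  not_hasRealQuadAnchor_of_span_int fun _ hv halg => eq_intCast_of_isAlgebraic_mem_span_zC hLW hv halg

/-- **THE COMBINED CARVE (mod the LW measure): the residual of record after g15 + this addendum.**
`Rank3SpanResidual ↔ ∀ z, ℚ-free → HyperLinLiouville → ¬HasHLPairInSpan → ¬HasRealQuadAnchor →
¬HasExpLatAnchor → SB 3 z` — both anchored chapters are decided. -/
theorem rank3SpanResidual_iff_unanchored₂ (hLW : LWMeasure) :
    Rank3SpanResidual ↔
      ∀ z : Fin 3 → ℂ, LinearIndependent ℚ z → HyperLinLiouville z → ¬ HasHLPairInSpan z →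
        ¬ HasRealQuadAnchor z → ¬ HasExpLatAnchor z → SB 3 z :=
  rank3SpanResidual_iff_of_cells (fun _ hz hH hA => sb_three_of_realQuadAnchor hLW hz hH hA)
    (fun _ hz hH hA => sb_three_of_expLatAnchor hLW hz hH hA)

/-- **PLACEMENT OF `z_C` (mod the LW measure; the three residual hypotheses and the X-anchor are
unconditional).**  `z_C` satisfies every hypothesis of `Rank3SpanResidual`, is OUTSIDE the tree's
pair cell (`¬HasHLPairInSpan`) and OUTSIDE the g15 cell (`¬HasRealQuadAnchor`), INSIDE the new X-cell
(`HasExpIntAnchor`), and Schanuel's bound holds for it. -/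
theorem placement_zC (hLW : LWMeasure) :
    LinearIndependent ℚ zC ∧ HyperLinLiouville zC ∧ ¬ HasHLPairInSpan zC ∧ ¬ HasRealQuadAnchor zC ∧
      HasExpIntAnchor zC ∧ SB 3 zC :=
  ⟨linearIndependent_zC, hyperLinLiouville_zC, not_hasHLPairInSpan_zC, not_hasRealQuadAnchor_zC hLW,
    hasExpIntAnchor_zC, sb_three_zC hLW⟩

end LatCell

end HyperCell

end Summit.Schanuel.Schanuel.Theorems.RootDecomp1KHyper
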